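import Mathlib.Algebra.MvPolynomial.Rename
import Mathlib.Algebra.BigOperators.Ring.Finset
import Mathlib.Algebra.BigOperators.Group.Multiset.Basic
import Mathlib.Data.Fintype.Pi
import Mathlib.Data.Fintype.Prod
import Mathlib.Data.Fintype.BigOperators
import Mathlib.Logic.Function.Basic
import Mathlib.Logic.Equiv.Basic
import HarnessLib

/-!
# Homomorphism polynomials and labelled pattern expressions (the bipartite graph algebra)

Topic `Computability/AlgebraicComplexity`, namespace `Literature.Computability.AlgebraicComplexity`.

A. Dawar, B. Pago, T. Seppelt, *Symmetric algebraic circuits and homomorphism polynomials*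
(arXiv:2502.06740, 2025) and P. Dwivedi, B. Pago, T. Seppelt (STOC 2026, arXiv:2601.09343, eq. (1))
study, on the `n × n` matrix of variables `x_ij`, the HOMOMORPHISM POLYNOMIAL of a bipartite
multigraph pattern `F = (A ⊔ B, E)`,
`hom_{F,n} = Σ_{h : A → [n]} Σ_{h' : B → [n]} Π_{ab ∈ E} x_{h(a) h'(b)}`,
and show that matrix-symmetric circuits of polynomial orbit size compute exactly the linear
combinations of homomorphism polynomials of patterns of bounded treewidth; the easy direction
(DPS25 §5, proof of Thm 5.3: "for every tuple `v ∈ [n]^ℓ` a gate which computes `F(v)`") builds,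
along a width-`k` tree decomposition, a symmetric circuit with `n^{O(k)} |F|` gates.

This file provides the DEFINITIONS in the tree's vocabulary (`MvPolynomial (Fin n × Fin n) R`):

* `homPoly E n R` — the homomorphism polynomial of the bipartite multigraph with edge multiset
  `E : Multiset (A × B)` (row-vertices `A`, column-vertices `B`, finite types);
  `rename_perm_homPoly` — it is invariant under independent row and column permutations.
* `PatternExpr R k l` — LABELLED PATTERN EXPRESSIONS, the term language of the bipartite graph
  algebra with `k` row labels and `l` column labels (Lovász's labelled quantum graphs — the
  algebraic form of tree decompositions of width `< k + l`): an edge between row label `a` and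
  column label `b`, constants, sums, products (= gluing), and `sumRow a` / `sumCol b` (= forgetting,
  i.e. summing out, a label, which may then be reused for a new vertex).
  `PatternExpr.value n e ρ γ` is the semantics at a row-label assignment `ρ : Fin k → Fin n` and a
  column-label assignment `γ : Fin l → Fin n` (a polynomial); `PatternExpr.close n e = Σ_{ρ, γ}
  value n e ρ γ` is the closed polynomial; `PatternExpr.length` counts the operations.
  `rename_value` — EQUIVARIANCE: relabelling both assignments by `(σ, τ)` is renaming the variables
  `x_ij ↦ x_{σ i, τ j}`; hence `rename_perm_close` — closed expressions are matrix-symmetric.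
  (That `hom_F` of a pattern of small treewidth is a closed expression of small width is folklore
  and not formalised here: the symmetric-circuit engine of route MonotoneRestoration, summit
  ValiantsHypothesis, consumes expressions, not decompositions.)

Everything here is a definition or a proved lemma; nothing is a named fact.
-/

noncomputable section

namespace Literature.Computability.AlgebraicComplexity

open MvPolynomial

universe u v

/-! ### Homomorphism polynomials -/

/-- **The homomorphism polynomial** `hom_{F,n}` of the bipartite multigraph pattern `F` with
row-vertex type `A`, column-vertex type `B` and edge multiset `E`, on the `n × n` variable matrix:
`Σ_{h : A → Fin n, h' : B → Fin n} Π_{(a,b) ∈ E} x_{h a, h' b}`.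
[cite: DwivediPagoSeppelt2026, eq. (1)] -/
def homPoly {A B : Type u} [Fintype A] [DecidableEq A] [Fintype B] [DecidableEq B]
    (E : Multiset (A × B)) (n : ℕ) (R : Type v)
    [CommSemiring R] : MvPolynomial (Fin n × Fin n) R :=
  ∑ h : (A → Fin n) × (B → Fin n),
    (E.map fun e => (X (h.1 e.1, h.2 e.2) : MvPolynomial (Fin n × Fin n) R)).prod

/-- **Homomorphism polynomials are matrix-symmetric**: renaming `x_ij ↦ x_{σ i, τ j}` permutes the
summands `(h, h') ↦ (σ ∘ h, τ ∘ h')`. [cite: DwivediPagoSeppelt2026, §1] -/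
theorem rename_perm_homPoly {A B : Type u} [Fintype A] [DecidableEq A] [Fintype B] [DecidableEq B]
    (E : Multiset (A × B)) (n : ℕ)
    (R : Type v) [CommSemiring R] (σ τ : Equiv.Perm (Fin n)) :
    rename (fun p : Fin n × Fin n => (σ p.1, τ p.2)) (homPoly E n R) = homPoly E n R := by
  unfold homPoly
  rw [map_sum]
  simp only [map_multiset_prod, Multiset.map_map, Function.comp_def, rename_X]
  exact Fintype.sum_equiv
    (Equiv.prodCongr ((Equiv.refl A).arrowCongr σ) ((Equiv.refl B).arrowCongr τ)) _ _
    fun h => rfl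

/-! ### Labelled pattern expressions -/

/-- **Labelled pattern expressions** over constants `R` with `k` row labels and `l` column labels
(the bipartite graph algebra): `edge a b` (the variable `x_{ρ a, γ b}`), `const c`, `add`, `mul`
(gluing), `sumRow a e = Σ_v e[ρ a := v]`, `sumCol b e = Σ_v e[γ b := v]` (forgetting a label).
[cite: DawarPagoSeppelt2025, §5] -/
inductive PatternExpr (R : Type v) (k l : ℕ) : Type v
  /-- The edge between row label `a` and column label `b`: the variable `x_{ρ a, γ b}`. -/
  | edge (a : Fin k) (b : Fin l) : PatternExpr R k l
  /-- A constant. -/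
  | const (c : R) : PatternExpr R k l
  /-- Sum of two expressions. -/
  | add (e₁ e₂ : PatternExpr R k l) : PatternExpr R k l
  /-- Product (gluing along all labels) of two expressions. -/
  | mul (e₁ e₂ : PatternExpr R k l) : PatternExpr R k l
  /-- Summing out the row label `a` (it may be reused afterwards). -/
  | sumRow (a : Fin k) (e : PatternExpr R k l) : PatternExpr R k l
  /-- Summing out the column label `b`. -/
  | sumCol (b : Fin l) (e : PatternExpr R k l) : PatternExpr R k l

namespace PatternExpr

variable {R : Type v} {k l : ℕ}

/-- The number of operations of an expression. [cite: DawarPagoSeppelt2025, §5] -/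
def length : PatternExpr R k l → ℕ
  | edge _ _ => 1
  | const _ => 1
  | add e₁ e₂ => e₁.length + e₂.length + 1
  | mul e₁ e₂ => e₁.length + e₂.length + 1
  | sumRow _ e => e.length + 1
  | sumCol _ e => e.length + 1

/-- Every expression has positive length. [folklore] -/
theorem length_pos (e : PatternExpr R k l) : 0 < e.length := by
  cases e <;> simp [length]

variable [CommSemiring R]

/-- **Semantics** of an expression on the `n × n` variable matrix at the label assignments
`ρ : Fin k → Fin n` (rows) and `γ : Fin l → Fin n` (columns). [cite: DawarPagoSeppelt2025, §5] -/
def value (n : ℕ) : PatternExpr R k l → (Fin k → Fin n) → (Fin l → Fin n) →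
    MvPolynomial (Fin n × Fin n) R
  | edge a b, ρ, γ => X (ρ a, γ b)
  | const c, _, _ => C c
  | add e₁ e₂, ρ, γ => value n e₁ ρ γ + value n e₂ ρ γ
  | mul e₁ e₂, ρ, γ => value n e₁ ρ γ * value n e₂ ρ γ
  | sumRow a e, ρ, γ => ∑ v : Fin n, value n e (Function.update ρ a v) γ
  | sumCol b e, ρ, γ => ∑ v : Fin n, value n e ρ (Function.update γ b v)

/-- The **closed polynomial** of an expression: the sum of its values over all label assignments
(for an expression all of whose labels have been summed out this is `n^{k+l}` times the value).
[cite: DawarPagoSeppelt2025, §5] -/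
def close (n : ℕ) (e : PatternExpr R k l) : MvPolynomial (Fin n × Fin n) R :=
  ∑ ρ : Fin k → Fin n, ∑ γ : Fin l → Fin n, value n e ρ γ

/-- `value` of an edge. [folklore] -/
@[simp] theorem value_edge (n : ℕ) (a : Fin k) (b : Fin l) (ρ : Fin k → Fin n) (γ : Fin l → Fin n) :
    value n (edge a b : PatternExpr R k l) ρ γ = X (ρ a, γ b) := rfl

/-- `value` of a constant. [folklore] -/
@[simp] theorem value_const (n : ℕ) (c : R) (ρ : Fin k → Fin n) (γ : Fin l → Fin n) :
    value n (const c : PatternExpr R k l) ρ γ = C c := rfl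

/-- `value` of a sum. [folklore] -/
@[simp] theorem value_add (n : ℕ) (e₁ e₂ : PatternExpr R k l) (ρ : Fin k → Fin n)
    (γ : Fin l → Fin n) : value n (add e₁ e₂) ρ γ = value n e₁ ρ γ + value n e₂ ρ γ := rfl

/-- `value` of a product. [folklore] -/
@[simp] theorem value_mul (n : ℕ) (e₁ e₂ : PatternExpr R k l) (ρ : Fin k → Fin n)
    (γ : Fin l → Fin n) : value n (mul e₁ e₂) ρ γ = value n e₁ ρ γ * value n e₂ ρ γ := rfl

/-- `value` of a summed-out row label. [folklore] -/
@[simp] theorem value_sumRow (n : ℕ) (a : Fin k) (e : PatternExpr R k l) (ρ : Fin k → Fin n)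
    (γ : Fin l → Fin n) :
    value n (sumRow a e) ρ γ = ∑ v : Fin n, value n e (Function.update ρ a v) γ := rfl

/-- `value` of a summed-out column label. [folklore] -/
@[simp] theorem value_sumCol (n : ℕ) (b : Fin l) (e : PatternExpr R k l) (ρ : Fin k → Fin n)
    (γ : Fin l → Fin n) :
    value n (sumCol b e) ρ γ = ∑ v : Fin n, value n e ρ (Function.update γ b v) := rfl

/-- **Equivariance of the semantics**: renaming the variables by `(σ, τ)` is relabelling both
assignments. [cite: DawarPagoSeppelt2025, §5] -/
theorem rename_value (n : ℕ) (σ τ : Equiv.Perm (Fin n)) (e : PatternExpr R k l) :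
    ∀ (ρ : Fin k → Fin n) (γ : Fin l → Fin n),
      rename (fun p : Fin n × Fin n => (σ p.1, τ p.2)) (value n e ρ γ) =
        value n e (σ ∘ ρ) (τ ∘ γ) := by
  induction e with
  | edge a b => intro ρ γ; simp [value]
  | const c => intro ρ γ; simp [value]
  | add e₁ e₂ ih₁ ih₂ => intro ρ γ; simp [value, ih₁, ih₂]
  | mul e₁ e₂ ih₁ ih₂ => intro ρ γ; simp [value, ih₁, ih₂]
  | sumRow a e ih =>
    intro ρ γ
    simp only [value, map_sum, ih, Function.comp_update]
    exact Fintype.sum_equiv σ _ _ fun v => rfl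
  | sumCol b e ih =>
    intro ρ γ
    simp only [value, map_sum, ih, Function.comp_update]
    exact Fintype.sum_equiv τ _ _ fun v => rfl

/-- **Closed pattern expressions are matrix-symmetric polynomials.** [cite: DawarPagoSeppelt2025, §5] -/
theorem rename_perm_close (n : ℕ) (σ τ : Equiv.Perm (Fin n)) (e : PatternExpr R k l) :
    rename (fun p : Fin n × Fin n => (σ p.1, τ p.2)) (close n e) = close n e := by
  unfold close
  simp only [map_sum, rename_value]
  rw [← Fintype.sum_equiv ((Equiv.refl (Fin k)).arrowCongr σ)
    (fun ρ => ∑ γ : Fin l → Fin n, value n e (σ ∘ ρ) (τ ∘ γ))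
    (fun ρ => ∑ γ : Fin l → Fin n, value n e ρ γ) ?_]
  intro ρ
  exact Fintype.sum_equiv ((Equiv.refl (Fin l)).arrowCongr τ) _ _ fun γ => rfl

end PatternExpr

end Literature.Computability.AlgebraicComplexity

end
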